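import Mathlib
import Summits.QuantumFields.Balaban3D.Carriers.Regions
import Summits.QuantumFields.Balaban3D.Proofs.CollarCount
import Summits.QuantumFields.Balaban3D.Proofs.TorusBalls

/-!
# `Summit.QuantumFields.Balaban3D.Proofs.Run3Collar` — lane «pub-balaban3d» (Bałaban, CMP **102** (1985) 255–275, d = 3 lattice UV
# stability AS PRINTED), prover seat p2: the COLLAR CHAIN and the COLLAR COUNT «|Z_j| ≤ Σ over the large-field plaquettes (i, p′),
# i ≤ j, of (c_g·R(g_i)M₁)³» ((39) p. 266, rule of pp. 267–268) for seat p1's regions `Carriers.Regions.Omega`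

HONEST FRAMING (lane PLAN.md §0).  Nothing of [B10] = [Balaban1985UV3] is asserted.  The 4D cell leaves this count unmodelled
(`B10LargeFieldSum.ZvolCover` is a hypothesis there; DIVERGENCE D-b10.7); here it is PROVED for the lane's concrete regions: p1 defines
`Ω_{k+1}(h)` by the printed rule taken as a definition (every site of the scale-(k+1) big block of `y` is at scale-`k` distance `> Rcol k`
from the sites covered by `P_k` and from `Ω_k(h)ᶜ`), so `y ∈ Z_j(h) = Ω_{j+1}(h)ᶜ` forces a CHAIN of collars down to some large-field
plaquette `p′ ∈ P_i`, `i ≤ j` (`collar_chain`: `sdist j c y ≤ 2(Rcol i + B + d) + 1` for a site `c` covered by `p′`, `B = L·d(M₁ − 1) +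
d(L − 1)`, using `Rcol` antitone and the contraction `…CollarCount.tdist_blockOf_le`), and the ball count `…TorusBalls.card_torusBall_le`
bounds the volume (`zvol_le_sum`).
-/

namespace Summit.QuantumFields.Balaban3D.Proofs.Run3Collar

open Literature.MathematicalPhysics.QuantumFieldTheory.Balaban1983to89
open Summit.QuantumFields.Balaban3D.Carriers
open Summit.QuantumFields.Balaban3D.Proofs.CollarCount
open B3Taylor310LocalRemainder (tdist_comm tdist_triangle)
open Summit.QuantumFields.Balaban3D.Proofs.TorusBalls (card_torusBall_le)
open Finset

variable {P : Params}

/-! ## §1 The scale-`j` distance `sdist` of p1's regions: metric facts -/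

section SDist

/-- `sdist` is symmetric. [folklore] -/
theorem sdist_comm (j : ℕ) (x y : Site P 0) : sdist j x y = sdist j y x := tdist_comm _ _

/-- `sdist` satisfies the triangle inequality. [folklore] -/
theorem sdist_triangle (j : ℕ) (x y z : Site P 0) : sdist j x z ≤ sdist j x y + sdist j y z := tdist_triangle _ _ _

/-- CONTRACTION along the scales: `sdist (j+1) x y ≤ sdist j x y / L + d`. [folklore] -/
theorem sdist_succ_le {j : ℕ} (hj : j + 1 ≤ P.m + P.K) (x y : Site P 0) :
    sdist (j + 1) x y ≤ sdist j x y / P.L + P.d :=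
  tdist_blockOf_le hj _ _

/-- EXPANSION along the scales: `sdist j x y ≤ L·sdist (j+1) x y + d(L − 1)`. [folklore] -/
theorem sdist_le_succ {j : ℕ} (hj : j + 1 ≤ P.m + P.K) (x y : Site P 0) :
    sdist j x y ≤ P.L * sdist (j + 1) x y + P.d * (P.L - 1) :=
  tdist_le_blockOf hj _ _

/-- Sites of the same scale-`(j+1)` big block are at scale-`j` distance `≤ L·d(M₁ − 1) + d(L − 1)`. [folklore] -/
theorem sdist_le_of_bigBlockOf_eq {M₁ : ℕ} (hM : 0 < M₁) {j : ℕ} (hj : j + 1 ≤ P.m + P.K) {x y : Site P 0}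
    (h : bigBlockOf M₁ (j + 1) x = bigBlockOf M₁ (j + 1) y) :
    sdist j x y ≤ P.L * (P.d * (M₁ - 1)) + P.d * (P.L - 1) := by
  have h1 : sdist (j + 1) x y ≤ P.d * (M₁ - 1) :=
    tdist_le_of_labels_div_eq _ _ hM fun μ => congrFun h μ
  calc sdist j x y ≤ P.L * sdist (j + 1) x y + P.d * (P.L - 1) := sdist_le_succ hj x y
    _ ≤ P.L * (P.d * (M₁ - 1)) + P.d * (P.L - 1) := Nat.add_le_add_right (Nat.mul_le_mul_left _ h1) _

end SDist

/-! ## §2 The collar chain: a site outside `Ω_k(h)` is within the accumulated collars of a large-field plaquette -/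

section Chain

variable (M₁ : ℕ) (Rcol : ℕ → ℕ)

/-- **THE COLLAR CHAIN** ((39) p. 266 «(L^jη)^{−1}dist(Ω_jᶜ, Ω_{j+1}) > R(g_j)M₁», rule of pp. 267–268; the 4D cell's `cover_chain`
for p1's concrete regions): if `y ∉ Ω_k(h)` (`1 ≤ k`), there are a scale `i < k`, a large-field plaquette `p ∈ P_i(h)` and a site `c`
covered by it with `sdist (k−1) c y ≤ 2(Rcol i + B + d) + 1`, `B = L·d(M₁ − 1) + d(L − 1)` — provided the collar widths are antitone
ON THE WINDOW `i ≤ j ≤ N` of scales in play (`Rcol j ≤ Rcol i`: `R(g_j) = R₁(1 + log g_j⁻¹)^{r₀}` decreases along the flow while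
`g_j ≤ 1`) and `L ≥ 2`. [cite: Balaban1985UV3, (39) p.266] -/
theorem collar_chain (hM : 0 < M₁) {N : ℕ} (hRcol : ∀ i j, i ≤ j → j ≤ N → Rcol j ≤ Rcol i) (hL : 2 ≤ P.L) :
    ∀ (k : ℕ), k ≤ P.m + P.K → k ≤ N → ∀ (h : Hist P k) (y : Site P 0), y ∉ Omega M₁ Rcol k h k →
      ∃ (i : ℕ) (hi : i < k) (p : Plaq P i), p ∈ h ⟨i, hi⟩ ∧ ∃ c ∈ plaqCover p,
        sdist (k - 1) c y ≤ 2 * (Rcol i + (P.L * (P.d * (M₁ - 1)) + P.d * (P.L - 1)) + P.d) + 1 := by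
  intro k
  induction k with
  | zero =>
    intro _ _ h y hy
    rw [Hist.eq_triv_zero h, Omega_triv] at hy
    exact absurd (Set.mem_univ y) hy
  | succ k ih =>
    intro hk hkN h y hy
    rw [mem_Omega_succ_self] at hy
    push Not at hy
    obtain ⟨y', hy', x, hx, hdist⟩ := hy
    have hyy : sdist k y' y ≤ P.L * (P.d * (M₁ - 1)) + P.d * (P.L - 1) := sdist_le_of_bigBlockOf_eq hM hk hy'
    rw [Nat.add_sub_cancel]
    rcases hx with ⟨p, hp, hxp⟩ | hxΩ
    · -- the source is a large-field plaquette of the last passage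
      refine ⟨k, Nat.lt_succ_self k, p, hp, x, hxp, ?_⟩
      calc sdist k x y ≤ sdist k x y' + sdist k y' y := sdist_triangle k x y' y
        _ ≤ Rcol k + (P.L * (P.d * (M₁ - 1)) + P.d * (P.L - 1)) := Nat.add_le_add hdist hyy
        _ ≤ 2 * (Rcol k + (P.L * (P.d * (M₁ - 1)) + P.d * (P.L - 1)) + P.d) + 1 := by omega
    · -- the source lies deeper: x ∉ Ω_k(proj h)
      cases k with
      | zero =>
        rw [Hist.eq_triv_zero h.proj, Omega_triv] at hxΩ
        exact absurd (Set.mem_univ x) hxΩ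
      | succ k =>
        obtain ⟨i, hi, p, hp, c, hc, hci⟩ := ih (by omega) (by omega) h.proj x hxΩ
        rw [Nat.add_sub_cancel] at hci
        refine ⟨i, by omega, p, ?_, c, hc, ?_⟩
        · simpa [Hist.proj] using hp
        · set B : ℕ := P.L * (P.d * (M₁ - 1)) + P.d * (P.L - 1) with hB_def
          set R : ℕ := 2 * (Rcol i + B + P.d) + 1 with hR_def
          have h1 : sdist (k + 1) c x ≤ R / P.L + P.d := (sdist_succ_le (by omega) c x).trans (by
            exact Nat.add_le_add_right (Nat.div_le_div_right hci) _)
          have h2 : R / P.L ≤ R / 2 := Nat.div_le_div_left hL (by norm_num)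
          have h3 : R / 2 = Rcol i + B + P.d := by omega
          have hRc : Rcol (k + 1) ≤ Rcol i := hRcol i (k + 1) (by omega) (by omega)
          calc sdist (k + 1) c y ≤ sdist (k + 1) c x + sdist (k + 1) x y := sdist_triangle _ c x y
            _ ≤ sdist (k + 1) c x + (sdist (k + 1) x y' + sdist (k + 1) y' y) :=
                Nat.add_le_add_left (sdist_triangle _ x y' y) _
            _ ≤ (R / P.L + P.d) + (Rcol (k + 1) + B) := Nat.add_le_add h1 (Nat.add_le_add hdist hyy)
            _ ≤ R := by omega

/-- Restriction of a history to its first `j` passages. [folklore] -/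
theorem Omega_castLE : ∀ (k : ℕ) (h : Hist P k) (j : ℕ) (hjk : j ≤ k),
    Omega M₁ Rcol k h j = Omega M₁ Rcol j (fun i => h (Fin.castLE hjk i)) j := by
  intro k
  induction k with
  | zero =>
    intro h j hjk
    have hj : j = 0 := by omega
    subst hj
    rfl
  | succ k ih =>
    intro h j hjk
    rcases Nat.eq_or_lt_of_le hjk with hj | hj
    · subst hj
      congr 1
    · rw [Omega_succ_of_le M₁ Rcol h (by omega), ih h.proj j (by omega)]
      rfl

end Chain

/-! ## §3 The collar count -/

section Count

variable (M₁ : ℕ) (Rcol : ℕ → ℕ)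

/-- A site is at `ℓ¹` torus distance `≤ 1` from its shift by one lattice step. [folklore] -/
theorem tdist_shift_le {i : ℕ} (x : Site P i) (μ : Fin P.d) : Site.tdist x (x.shift μ) ≤ 1 := by
  classical
  unfold Site.tdist
  have hone : (1 : ZMod (P.sitesPerDir i)).val ≤ 1 := by
    rw [ZMod.val_one_eq_one_mod]; exact Nat.mod_le 1 _
  have hterm : ∀ κ, min (x κ - x.shift μ κ).val (x.shift μ κ - x κ).val ≤ if κ = μ then 1 else 0 := by
    intro κ
    by_cases hκ : κ = μ
    · subst hκ
      simp only [Site.shift, Function.update_self, if_true]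
      refine (min_le_right _ _).trans ?_
      rw [add_sub_cancel_left]
      exact hone
    · simp [Site.shift, hκ]
  calc ∑ κ, min (x κ - x.shift μ κ).val (x.shift μ κ - x κ).val ≤ ∑ κ : Fin P.d, (if κ = μ then 1 else 0) :=
        Finset.sum_le_sum fun κ _ => hterm κ
    _ = 1 := by simp

/-- A site covered by a plaquette has its scale-`i` block within distance `2` of the plaquette's base point. [folklore] -/
theorem tdist_src_le_of_mem_plaqCover {i : ℕ} {p : Plaq P i} {c : Site P 0} (hc : c ∈ plaqCover p) :
    Site.tdist p.src (coarsen i c) ≤ 2 := by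
  rcases hc with h | h | h | h <;> rw [h]
  · unfold Site.tdist; simp
  · exact (tdist_shift_le p.src p.μ).trans (by norm_num)
  · exact (tdist_shift_le p.src p.ν).trans (by norm_num)
  · calc Site.tdist p.src ((p.src.shift p.μ).shift p.ν)
        ≤ Site.tdist p.src (p.src.shift p.μ) + Site.tdist (p.src.shift p.μ) ((p.src.shift p.μ).shift p.ν) :=
          tdist_triangle _ _ _
      _ ≤ 1 + 1 := Nat.add_le_add (tdist_shift_le _ _) (tdist_shift_le _ _)

/-- Two sites covered by the same scale-`i` plaquette stay within scale-`(i+m)` distance `2d + 6` of each other for every later scale in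
the standing range (corners: `≤ 4`; then contraction). [folklore] -/
theorem sdist_le_of_mem_plaqCover (hL : 2 ≤ P.L) {i : ℕ} {p : Plaq P i} {c c' : Site P 0} (hc : c ∈ plaqCover p)
    (hc' : c' ∈ plaqCover p) : ∀ (m : ℕ), i + m ≤ P.m + P.K → sdist (i + m) c c' ≤ 2 * P.d + 6 := by
  intro m
  induction m with
  | zero =>
    intro _
    show Site.tdist (coarsen i c) (coarsen i c') ≤ 2 * P.d + 6
    calc Site.tdist (coarsen i c) (coarsen i c')
        ≤ Site.tdist (coarsen i c) p.src + Site.tdist p.src (coarsen i c') := tdist_triangle _ _ _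
      _ ≤ 2 + 2 := by
          refine Nat.add_le_add ?_ (tdist_src_le_of_mem_plaqCover hc')
          rw [tdist_comm]; exact tdist_src_le_of_mem_plaqCover hc
      _ ≤ 2 * P.d + 6 := by omega
  | succ m ih =>
    intro hm
    have h1 := sdist_succ_le (j := i + m) (by omega) c c'
    have h2 := ih (by omega)
    have h3 : sdist (i + m) c c' / P.L ≤ sdist (i + m) c c' / 2 := Nat.div_le_div_left hL (by norm_num)
    rw [← Nat.add_assoc]
    omega

open Classical in
/-- **THE COLLAR COUNT** ((39) p. 266, (41) «|Z_j|»; the 4D cell's `B10LargeFieldSum.ZvolCover`, there a hypothesis, DIVERGENCE D-b10.7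
«lattice ball count not modelled»): for p1's regions, the number of scale-`j` sites whose block meets `Z_j(h)` is at most the sum,
over the large-field plaquettes `p ∈ P_i(h)`, `i ≤ j`, of the ball count `(2(ϱ_i + 1))^d`, `ϱ_i = 2(Rcol i + B + d) + 1 + (2d + 6)`
(chain radius + the spread of the covered sites). [cite: Balaban1985UV3, (39) p.266, (41) p.266] -/
theorem zvol_le_sum (hM : 0 < M₁) {N : ℕ} (hRcol : ∀ i j, i ≤ j → j ≤ N → Rcol j ≤ Rcol i) (hL : 2 ≤ P.L) {k : ℕ}
    (hk : k ≤ P.m + P.K) (hkN : k ≤ N) (h : Hist P k) {j : ℕ} (hjk : j + 1 ≤ k) :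
    ZVol M₁ Rcol k h j ≤ ∑ i : Fin (j + 1), (h (Fin.castLE hjk i)).card *
      (2 * ((2 * (Rcol i + (P.L * (P.d * (M₁ - 1)) + P.d * (P.L - 1)) + P.d) + 1 + (2 * P.d + 6)) + 1)) ^ P.d := by
  classical
  set B : ℕ := P.L * (P.d * (M₁ - 1)) + P.d * (P.L - 1) with hB_def
  set h' : Hist P (j + 1) := fun i => h (Fin.castLE hjk i) with hh'_def
  -- the region of a source (i, p): sites within the chain radius of a covered site
  let G : (i : Fin (j + 1)) → Plaq P i → Finset (Site P j) := fun i p =>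
    Finset.univ.filter fun z => ∃ c : Site P 0, c ∈ plaqCover p ∧ Site.tdist (coarsen j c) z ≤ 2 * (Rcol i + B + P.d) + 1
  -- every counted site lies in some source region
  have hsub : (Finset.univ.filter fun z : Site P j => ∃ x : Site P 0, coarsen j x = z ∧ x ∈ Zreg M₁ Rcol h j) ⊆
      (Finset.univ : Finset (Fin (j + 1))).biUnion fun i => (h' i).biUnion fun p => G i p := by
    intro z hz
    rw [Finset.mem_filter] at hz
    obtain ⟨x, rfl, hx⟩ := hz.2
    have hx' : x ∉ Omega M₁ Rcol (j + 1) h' (j + 1) := by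
      have := Omega_castLE M₁ Rcol k h (j + 1) hjk
      unfold Zreg at hx
      rwa [this] at hx
    obtain ⟨i, hi, p, hp, c, hc, hci⟩ := collar_chain M₁ Rcol hM hRcol hL (j + 1) (by omega) (by omega) h' x hx'
    rw [Nat.add_sub_cancel] at hci
    rw [Finset.mem_biUnion]
    refine ⟨⟨i, hi⟩, Finset.mem_univ _, ?_⟩
    rw [Finset.mem_biUnion]
    exact ⟨p, hp, Finset.mem_filter.mpr ⟨Finset.mem_univ _, c, hc, hci⟩⟩
  -- each source region is a ball of radius (chain radius + spread)
  have hG : ∀ (i : Fin (j + 1)) (p : Plaq P i),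
      (G i p).card ≤ (2 * ((2 * (Rcol i + B + P.d) + 1 + (2 * P.d + 6)) + 1)) ^ P.d := by
    intro i p
    rcases (G i p).eq_empty_or_nonempty with hE | ⟨z₀, hz₀⟩
    · rw [hE, Finset.card_empty]; exact Nat.zero_le _
    · obtain ⟨-, c₀, hc₀, _⟩ := Finset.mem_filter.mp hz₀
      refine le_trans (Finset.card_le_card ?_) (card_torusBall_le (coarsen j c₀) _)
      intro z hz
      obtain ⟨-, c, hc, hcz⟩ := Finset.mem_filter.mp hz
      rw [Finset.mem_filter]
      refine ⟨Finset.mem_univ _, ?_⟩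
      have hcc : sdist j c₀ c ≤ 2 * P.d + 6 := by
        have := sdist_le_of_mem_plaqCover hL hc₀ hc (j - i) (by omega)
        rwa [Nat.add_sub_cancel' (by omega : (i : ℕ) ≤ j)] at this
      calc Site.tdist (coarsen j c₀) z ≤ Site.tdist (coarsen j c₀) (coarsen j c) + Site.tdist (coarsen j c) z :=
            tdist_triangle _ _ _
        _ ≤ (2 * P.d + 6) + (2 * (Rcol i + B + P.d) + 1) := Nat.add_le_add hcc hcz
        _ = 2 * (Rcol i + B + P.d) + 1 + (2 * P.d + 6) := by ring
  unfold ZVol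
  calc _ ≤ ((Finset.univ : Finset (Fin (j + 1))).biUnion fun i => (h' i).biUnion fun p => G i p).card :=
        Finset.card_le_card hsub
    _ ≤ ∑ i : Fin (j + 1), ((h' i).biUnion fun p => G i p).card := Finset.card_biUnion_le
    _ ≤ ∑ i : Fin (j + 1), ∑ p ∈ h' i, (G i p).card :=
        Finset.sum_le_sum fun i _ => Finset.card_biUnion_le
    _ ≤ ∑ i : Fin (j + 1), ∑ _p ∈ h' i, (2 * ((2 * (Rcol i + B + P.d) + 1 + (2 * P.d + 6)) + 1)) ^ P.d :=
        Finset.sum_le_sum fun i _ => Finset.sum_le_sum fun p _ => hG i p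
    _ = _ := by
        refine Finset.sum_congr rfl fun i _ => ?_
        rw [Finset.sum_const, smul_eq_mul]
        rfl

end Count

end Summit.QuantumFields.Balaban3D.Proofs.Run3Collar
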